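import Summits.BirchSwinnertonDyer.BirchSwinnertonDyer.Theorems.AdditiveBranchIMCGordTwoRankZeroOffCaseOneFieldSupplyR0Aux
import Summits.BirchSwinnertonDyer.BirchSwinnertonDyer.Theorems.AdditiveBranchIMCGordTwoRankZeroOffCaseOneFieldSupplyR0Local
import Summits.BirchSwinnertonDyer.BirchSwinnertonDyer.Theorems.AdditiveBranchIMCGordTwoRankZeroOffCaseOneFieldSupplyR0Partner
import Summits.BirchSwinnertonDyer.BirchSwinnertonDyer.Theorems.AdditiveBranchIMCGordTwoRankZeroOffCaseOneFieldSupplyR0Arith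
import Literature.NumberTheory.QuadraticFields.FundamentalDiscriminant
import Literature.NumberTheory.EllipticCurves.NonvanishingTwistsPrescribedRamificationOfHoffsteinLuoProofs
import Literature.NumberTheory.EllipticCurves.NonvanishingTwistsProofs
import Literature.NumberTheory.EllipticCurves.LFunctionSmulProofs
import HarnessLib

/-!
# Route `AdditiveBranchIMC`, crux `GordTwoRankZeroOffCaseOne` (stmt-BirchSwinnertonDyer-19357): (F2₂) the genus-class FIELD TWO over a road field in
# which `2` RAMIFIES — part 1/3: §1 genus factorisation, §2 the Dirichlet prime, §3 the auxiliary twist of root number `−1`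

Theorems-side landing (prover bsd-addord-stub-2 g0, `--supports stmt-BirchSwinnertonDyer-19357`, helper only) of the pen's checked crux workfile
`Cruxes/GordTwoRankZeroOffCaseOne/WanAnyFieldTwoR0Landing.lean` (bsd-addord-plan gen 44, commit 7fa9383eae77; = `WanAnyFieldTwoR0.lean` v2 b8469de9518d §1–§5,
TARGET E356 (a)–(e), E357), declarations and proofs VERBATIM, split MECHANICALLY along its sections into three ≤ 400-line modules
(`…FieldSupplyTwoR0Aux` §1–§3 ⟵ `…FieldSupplyTwoR0Class` §4 ⟵ `…FieldSupplyTwoR0` §5 with `fieldTwoTwo_supply`, statement = the body of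
`WanAnyRoad.FieldTwoTwo`). This part: §1 `genusFactor_two_spec` (`d_K = e₂·δ`, `e₂ ∈ {−4, 8, −8}`); §2 `exists_prime_star_prescribed_of_emod_four` /
`exists_prime_star_prescribed_two` (Dirichlet prime with `(p*·δ·ℓ₀*) ≡ 1 (mod 8)`); §3 `exists_auxTwist_two`. 0 sorries. BSD is proved for no curve by any of this.
[cite: FriedbergHoffstein1995, Theorem B] [cite: HoffsteinLuo1997, Theorem] [cite: SilvermanAEC2009, VII.5.4 and App. C §16]
-/

set_option linter.dupNamespace false

noncomputable section

open scoped Classical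

open WeierstrassCurve NumberField IsDedekindDomain Rat.HeightOneSpectrum
  Literature.NumberTheory.EllipticCurves
  Literature.NumberTheory.EllipticCurves.ModularForms
  Literature.NumberTheory.EllipticCurves.Rank1Residual
  Literature.NumberTheory.QuadraticFields
  Summit.BirchSwinnertonDyer.Rank1Residual
  Summit.BirchSwinnertonDyer.Rank1Residual.Additive

namespace Summit.BirchSwinnertonDyer.BirchSwinnertonDyer.Theorems.WanAnyRoad

open NumberTheorySymbols ZMod
open Summit.BirchSwinnertonDyer.BirchSwinnertonDyer.Theorems.ThreeFieldRoadSupply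
open Summit.BirchSwinnertonDyer.BirchSwinnertonDyer.Theorems.AdditiveKoly.RamifiedHabitat (pStar_emod_four eq_of_prime_dvd_pStar)
open Literature.NumberTheory.EllipticCurves.Castella2018.TamagawaQuadratic

/-! ### §1 The genus factorisation of an EVEN road-field discriminant (E356 (a)) -/

section GenusFactorTwo

variable {p : ℕ} [hp : Fact p.Prime] (W : WeierstrassCurve ℚ) (K : Type) [Field K] [NumberField K]

/-- **The genus factor of a road field in which `2` ramifies.** For `K` imaginary quadratic with `2 ∣ d_K`, every ODD prime
`ℓ ∣ N_E` split in `K`, and `p ∣ N_E` odd: `d_K = e₂·δ₁` with `e₂ ∈ {−4, 8, −8}`, `δ₁ ≡ 1 (mod 4)`, `δ₁` square-free and odd,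
`p ∤ δ₁`, and no prime of `δ₁` divides `N_E`. [cite: Cox2013, §1.C Lemma 1.14 (genus factorisation of a discriminant)] -/
theorem genusFactor_two_spec (hK : IsImaginaryQuadratic K) (h2d : (2 : ℤ) ∣ NumberField.discr K)
    (hsplit : ∀ ℓ : ℕ, ℓ.Prime → ℓ ∣ W.conductorNorm ℤ → ℓ ≠ 2 →
      ((Ideal.span {(ℓ : ℤ)}).primesOver (𝓞 K)).ncard = 2)
    (hpN : p ∣ W.conductorNorm ℤ) :
    ∃ e₂ δ : ℤ, (e₂ = -4 ∨ e₂ = 8 ∨ e₂ = -8) ∧ NumberField.discr K = e₂ * δ ∧ δ % 4 = 1 ∧ Squarefree δ ∧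
      ¬ (2 : ℤ) ∣ δ ∧ ¬ (p : ℤ) ∣ δ ∧
      (∀ ℓ : ℕ, ℓ.Prime → (ℓ : ℤ) ∣ δ → ¬ ℓ ∣ W.conductorNorm ℤ) := by
  set d : ℤ := NumberField.discr K with hd
  -- primes of an odd divisor of `d_K` are good primes of `E` (an odd bad prime splits, hence does not ramify)
  have hgood : ∀ δ : ℤ, δ ∣ d → ¬ (2 : ℤ) ∣ δ → ∀ ℓ : ℕ, ℓ.Prime → (ℓ : ℤ) ∣ δ → ¬ ℓ ∣ W.conductorNorm ℤ := by
    intro δ hδd hδ2 ℓ hℓ hℓδ hℓN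
    have hℓd : (ℓ : ℤ) ∣ d := hℓδ.trans hδd
    have hℓ2 : ℓ ≠ 2 := by rintro rfl; exact hδ2 (by exact_mod_cast hℓδ)
    have hs := hsplit ℓ hℓ hℓN hℓ2
    exact Literature.SatisfiesHeegnerHypothesis.not_dvd_discr hK.1
      (N := ℓ) (fun r hr hrℓ ↦ by rwa [(Nat.prime_dvd_prime_iff_eq hr hℓ).mp hrℓ]) hℓ dvd_rfl hℓd
  have hsqneg : ∀ x : ℤ, Squarefree x → Squarefree (-x) := fun x hx ↦
    Int.squarefree_natAbs.mp (by rw [Int.natAbs_neg]; exact Int.squarefree_natAbs.mpr hx)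
  rcases Literature.NumberTheory.QuadraticFields.Quadratic.isFundamentalDiscriminant_discr (K := K) hK.1 with
    ⟨h1, -, -⟩ | ⟨h4, hm4, hsqm⟩
  · exfalso
    rw [← hd] at h1
    have : (2 : ℤ) ∣ d := h2d
    omega
  · rw [← hd] at h4 hm4 hsqm
    set m : ℤ := d / 4 with hm
    have hdm : d = 4 * m := by rw [hm]; exact (Int.mul_ediv_cancel' h4).symm
    rcases hm4 with hm2 | hm3
    · -- `m = 2 m'` with `m'` odd: `e₂ = ±8`, `δ₁ = ±m'`
      set m' : ℤ := m / 2 with hm'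
      have hmm' : m = 2 * m' := by omega
      have hsqm' : Squarefree m' := hsqm.squarefree_of_dvd ⟨2, by rw [hmm']; ring⟩
      by_cases h1 : m' % 4 = 1
      · have hδd : m' ∣ d := ⟨8, by rw [hdm, hmm']; ring⟩
        have hδ2 : ¬ (2 : ℤ) ∣ m' := by omega
        exact ⟨8, m', Or.inr (Or.inl rfl), by rw [hdm, hmm']; ring, h1, hsqm', hδ2,
          fun h ↦ hgood m' hδd hδ2 p hp.out h hpN, hgood m' hδd hδ2⟩
      · have hδd : -m' ∣ d := ⟨-8, by rw [hdm, hmm']; ring⟩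
        have hδ2 : ¬ (2 : ℤ) ∣ -m' := by omega
        exact ⟨-8, -m', Or.inr (Or.inr rfl), by rw [hdm, hmm']; ring, by omega, hsqneg m' hsqm', hδ2,
          fun h ↦ hgood (-m') hδd hδ2 p hp.out h hpN, hgood (-m') hδd hδ2⟩
    · -- `m ≡ 3 (mod 4)`: `e₂ = −4`, `δ₁ = −m`
      have hδd : -m ∣ d := ⟨-4, by rw [hdm]; ring⟩
      have hδ2 : ¬ (2 : ℤ) ∣ -m := by omega
      exact ⟨-4, -m, Or.inl rfl, by rw [hdm]; ring, by omega, hsqneg m hsqm, hδ2,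
        fun h ↦ hgood (-m) hδd hδ2 p hp.out h hpN, hgood (-m) hδd hδ2⟩

end GenusFactorTwo

/-! ### §2 The Dirichlet prime for any modulus factor `m ≡ 1 (mod 4)` (E356 (b)) -/


/-- **A Dirichlet prime with prescribed sign, prescribed Legendre symbols, and `m·ℓ₀* ≡ 1 (mod 8)` for any `m ≡ 1 (mod 4)`**
(generalises `exists_prime_star_prescribed`, whose `m = p*q*`). [folklore: CRT + Dirichlet; cite: IrelandRosen1990, Ch. 5 §2] -/
theorem exists_prime_star_prescribed_of_emod_four {m : ℤ} (hm4 : m % 4 = 1)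
    {σ : ℤ} (hσ : σ = 1 ∨ σ = -1) (S : Finset ℕ) (hS : ∀ ℓ ∈ S, ℓ.Prime ∧ ℓ ≠ 2)
    (η : ℕ → ℤ) (hη : ∀ ℓ ∈ S, η ℓ = 1 ∨ η ℓ = -1) (B : ℕ) :
    ∃ ℓ₀ : ℕ, ℓ₀.Prime ∧ B < ℓ₀ ∧ ((-1 : ℤ) ^ (ℓ₀ / 2)) = σ ∧
      (m * ((-1 : ℤ) ^ (ℓ₀ / 2) * ℓ₀)) % 8 = 1 ∧
      ∀ ℓ ∈ S, J((-1 : ℤ) ^ (ℓ₀ / 2) * ℓ₀ | ℓ) = η ℓ := by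
  have hm2 : m % 2 = 1 := by omega
  -- the class modulo `8`
  set c : ℕ := ((σ * m) % 8).toNat with hc
  have hc0 : (0 : ℤ) ≤ (σ * m) % 8 := Int.emod_nonneg _ (by norm_num)
  have hcZ : (c : ℤ) = (σ * m) % 8 := by rw [hc, Int.toNat_of_nonneg hc0]
  have hσm2 : (σ * m) % 2 = 1 := by rcases hσ with rfl | rfl <;> omega
  have hc2 : c % 2 = 1 := by
    have : (c : ℤ) % 2 = 1 := by rw [hcZ]; omega
    omega
  have hc4 : (c : ℤ) % 4 = if σ = 1 then 1 else 3 := by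
    rw [hcZ]
    rcases hσ with rfl | rfl
    · simp only [if_true]; omega
    · simp only [show (-1 : ℤ) ≠ 1 by decide, if_false]; omega
  -- the prescribed residues, corrected by `J((−1)^{(c−1)/2} | ℓ)`
  set s : ℤ := (-1 : ℤ) ^ (c / 2) with hs
  have hs1 : s = 1 ∨ s = -1 := neg_one_pow_eq_or ℤ _
  have hsℓ : ∀ ℓ ∈ S, J(s | ℓ) = 1 ∨ J(s | ℓ) = -1 := fun ℓ hℓ ↦ by
    refine jacobiSym.eq_one_or_neg_one ?_
    rcases hs1 with h | h <;> rw [h] <;> simp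
  obtain ⟨ℓ₀, hℓ₀, hBℓ₀, hℓ₀8, hJ⟩ := exists_prime_jacobiSym_prescribed S hS (fun ℓ ↦ J(s | ℓ) * η ℓ)
    (fun ℓ hℓ ↦ by
      rcases hsℓ ℓ hℓ with h | h <;> rcases hη ℓ hℓ with h' | h' <;> rw [h, h'] <;> norm_num) c hc2 B
  have hℓ₀odd : ℓ₀ % 2 = 1 := by omega
  -- `(−1)^{(ℓ₀−1)/2} = (−1)^{(c−1)/2} = σ`
  have hstar : ((-1 : ℤ) ^ (ℓ₀ / 2)) = s := by
    rw [hs, ← ZMod.χ₄_eq_neg_one_pow hℓ₀odd, ← ZMod.χ₄_eq_neg_one_pow hc2, ZMod.χ₄_nat_mod_four,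
      ZMod.χ₄_nat_mod_four (n := c)]
    congr 2
    omega
  have hsσ : s = σ := by
    rw [hs, ← ZMod.χ₄_eq_neg_one_pow hc2, ZMod.χ₄_nat_eq_if_mod_four]
    simp only [hc2, one_ne_zero, if_false]
    rcases hσ with rfl | rfl
    · simp only [if_true] at hc4
      rw [if_pos (by omega)]
    · simp only [show (-1 : ℤ) ≠ 1 by decide, if_false] at hc4
      rw [if_neg (by omega)]
  refine ⟨ℓ₀, hℓ₀, hBℓ₀, hstar.trans hsσ, ?_, fun ℓ hℓ ↦ ?_⟩
  · -- `m · (σ ℓ₀) ≡ m σ σ m = m² ≡ 1 (mod 8)`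
    rw [hstar, hsσ]
    have hℓ₀Z : (ℓ₀ : ℤ) % 8 = (σ * m) % 8 := by
      have h1 : (ℓ₀ : ℤ) % 8 = (c : ℤ) % 8 := by exact_mod_cast hℓ₀8
      rw [h1, hcZ, Int.emod_emod_of_dvd _ (dvd_refl (8 : ℤ))]
    have hσσ : σ * σ = 1 := by rcases hσ with rfl | rfl <;> norm_num
    calc (m * (σ * (ℓ₀ : ℤ))) % 8 = ((m * σ) * (ℓ₀ : ℤ)) % 8 := by congr 1; ring
      _ = ((m * σ) % 8) * ((ℓ₀ : ℤ) % 8) % 8 := Int.mul_emod _ _ _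
      _ = ((m * σ) % 8) * ((σ * m) % 8) % 8 := by rw [hℓ₀Z]
      _ = ((m * σ) * (σ * m)) % 8 := (Int.mul_emod _ _ _).symm
      _ = (m * m) % 8 := by rw [show m * σ * (σ * m) = (σ * σ) * (m * m) by ring, hσσ, one_mul]
      _ = 1 := Int.mul_self_emod_eight_of_odd hm2
  · rw [hstar, jacobiSym.mul_left, hJ ℓ hℓ, ← mul_assoc, ← sq]
    rcases hsℓ ℓ hℓ with h | h <;> rw [h] <;> norm_num

/-- **The Dirichlet prime at the Wan prime `2`** (E356 (b) as used in (c)): for an odd prime `p` and an odd genus factor `δ ≡ 1 (mod 4)`,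
a prime `ℓ₀ > B` with prescribed sign and Legendre symbols and `p*·δ·ℓ₀* ≡ 1 (mod 8)`. -/
theorem exists_prime_star_prescribed_two {p : ℕ} (hp : p.Prime) (hp2 : p ≠ 2) {δ : ℤ} (hδ4 : δ % 4 = 1)
    {σ : ℤ} (hσ : σ = 1 ∨ σ = -1) (S : Finset ℕ) (hS : ∀ ℓ ∈ S, ℓ.Prime ∧ ℓ ≠ 2)
    (η : ℕ → ℤ) (hη : ∀ ℓ ∈ S, η ℓ = 1 ∨ η ℓ = -1) (B : ℕ) :
    ∃ ℓ₀ : ℕ, ℓ₀.Prime ∧ B < ℓ₀ ∧ ((-1 : ℤ) ^ (ℓ₀ / 2)) = σ ∧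
      (((-1 : ℤ) ^ (p / 2) * p) * δ * ((-1 : ℤ) ^ (ℓ₀ / 2) * ℓ₀)) % 8 = 1 ∧
      ∀ ℓ ∈ S, J((-1 : ℤ) ^ (ℓ₀ / 2) * ℓ₀ | ℓ) = η ℓ := by
  -- `p* ≡ 1 (mod 4)` (verbatim from `exists_prime_star_prescribed`)
  have hpodd : (p : ℤ) % 2 = 1 := by exact_mod_cast Nat.odd_iff.mp (hp.eq_two_or_odd'.resolve_left hp2)
  have hps4 : ((-1 : ℤ) ^ (p / 2) * p) % 4 = 1 := by
    have hp4 : (p : ℤ) % 4 = 1 ∨ (p : ℤ) % 4 = 3 := by omega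
    have : ((-1 : ℤ) ^ (p / 2)) = if p % 4 = 1 then 1 else -1 := by
      rw [← ZMod.χ₄_eq_neg_one_pow (by exact_mod_cast hpodd), ZMod.χ₄_nat_eq_if_mod_four]
      simp only [show p % 2 = 1 by exact_mod_cast hpodd, one_ne_zero, if_false]
    rw [this]
    split_ifs with h4
    · omega
    · have : (p : ℤ) % 4 = 3 := by omega
      rw [Int.mul_emod, this]; decide
  have hm4 : (((-1 : ℤ) ^ (p / 2) * p) * δ) % 4 = 1 := by
    rw [Int.mul_emod, hps4, hδ4]; decide
  exact exists_prime_star_prescribed_of_emod_four hm4 hσ S hS η hη B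


/-! ### §3 The auxiliary twist of root number `−1` at the Wan prime `2` (E356 (c)) -/

section AuxTwistTwo

variable (W : WeierstrassCurve ℚ) [W.IsElliptic] [W.IsGloballyMinimal] (p : ℕ) [hp : Fact p.Prime]
  (K : Type) [Field K] [NumberField K]

set_option maxHeartbeats 800000 in
/-- **FIELD 2 at the Wan prime `2`, step 1 — the auxiliary twist of root number `−1`** (the `q = 2` port of `exists_auxTwist`).
For `(E, p)` on the (G-ord, `e = 2`) cell with `p ≥ 5`, `w(E) = +1`, and a road field `K` with `2 ∣ d_K` (the Wan prime `2`
RAMIFIED) and every ODD bad prime split: the good-ordinary partner `V` (`E ≅ V^{(p*)}`), the genus factorisation `d_K = e₂·δ₁`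
(`e₂ ∈ {−4, 8, −8}`, `δ₁ ≡ 1 (mod 4)` odd), a Dirichlet prime `ℓ₀` outside `2·N_E·M₀·d_K` with `(ℓ₀*/ℓ) = (p*e₂/ℓ)` at the odd primes
`ℓ ≠ p` of `N_E M₀` and the IMPOSED congruence `p*·δ₁·ℓ₀* ≡ 1 (mod 8)`, and a globally minimal `X ≅ V^{(T)}`, `T = δ₁ℓ₀*`, with
`T ≡ 1 (mod 4)`, `p*T < 0`, `(p*T/ℓ) = 1` at the odd primes of `N_V`, `p*T ≡ 1 (mod 8)` (unconditionally), and `w(X) = −1`.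
[cite: SilvermanAEC2009, X.5 Cor. 5.4 and App. C §16] [cite: IrelandRosen1990, Ch. 16 §1] [cite: Cox2013, §1.C Lemma 1.14] -/
theorem exists_auxTwist_two
    (hmod : exists_isNewformOf) (hp5 : 5 ≤ p) (hw : W.rootNumber = 1) (hcell : N10.CellGordTwo W p)
    (hK : IsImaginaryQuadratic K) (h2d : (2 : ℤ) ∣ NumberField.discr K)
    (hsplit : ∀ ℓ : ℕ, ℓ.Prime → ℓ ∣ W.conductorNorm ℤ → ℓ ≠ 2 →
      ((Ideal.span {(ℓ : ℤ)}).primesOver (𝓞 K)).ncard = 2) (M₀ : ℕ) (hM₀ : M₀ ≠ 0) :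
    ∃ (V : WeierstrassCurve ℚ) (_ : V.IsElliptic) (_ : V.IsGloballyMinimal) (C' : VariableChange ℚ)
      (e₂ δ : ℤ) (ℓ₀ : ℕ) (X : WeierstrassCurve ℚ) (_ : X.IsElliptic) (_ : X.IsGloballyMinimal)
      (CX : VariableChange ℚ),
      C' • V.quadraticTwist ((-1 : ℚ) ^ (p / 2) * p) = W ∧ GoodOrd V p ∧
      W.conductorNorm ℤ = V.conductorNorm ℤ * p ^ 2 ∧
      (e₂ = -4 ∨ e₂ = 8 ∨ e₂ = -8) ∧ NumberField.discr K = e₂ * δ ∧ δ % 4 = 1 ∧ Squarefree δ ∧ ¬ (2 : ℤ) ∣ δ ∧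
      ¬ (p : ℤ) ∣ δ ∧ δ ≠ 0 ∧
      ℓ₀.Prime ∧ ℓ₀ ≠ p ∧ ℓ₀ ≠ 2 ∧ ¬ ℓ₀ ∣ W.conductorNorm ℤ * M₀ ∧ ¬ (ℓ₀ : ℤ) ∣ δ ∧ ¬ (ℓ₀ : ℤ) ∣ NumberField.discr K ∧
      (((-1 : ℤ) ^ (p / 2) * p) * δ * ((-1 : ℤ) ^ (ℓ₀ / 2) * ℓ₀)) % 8 = 1 ∧
      (∀ ℓ : ℕ, ℓ.Prime → ℓ ∣ W.conductorNorm ℤ * M₀ → ℓ ≠ 2 → ℓ ≠ p →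
        J((-1 : ℤ) ^ (ℓ₀ / 2) * ℓ₀ | ℓ) = J(((-1 : ℤ) ^ (p / 2) * p) * e₂ | ℓ)) ∧
      (δ * ((-1 : ℤ) ^ (ℓ₀ / 2) * ℓ₀)) % 4 = 1 ∧
      ((-1 : ℤ) ^ (p / 2) * p) * (δ * ((-1 : ℤ) ^ (ℓ₀ / 2) * ℓ₀)) < 0 ∧
      (∀ ℓ : ℕ, ℓ.Prime → ℓ ∣ V.conductorNorm ℤ → ℓ ≠ 2 →
        J(((-1 : ℤ) ^ (p / 2) * p) * (δ * ((-1 : ℤ) ^ (ℓ₀ / 2) * ℓ₀)) | ℓ) = 1) ∧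
      (((-1 : ℤ) ^ (p / 2) * p) * (δ * ((-1 : ℤ) ^ (ℓ₀ / 2) * ℓ₀))) % 8 = 1 ∧
      CX • X = V.quadraticTwist ((δ * ((-1 : ℤ) ^ (ℓ₀ / 2) * ℓ₀) : ℤ) : ℚ) ∧ X.rootNumber = -1 := by
  have hp2 : p ≠ 2 := by omega
  -- notation
  set ps : ℤ := (-1 : ℤ) ^ (p / 2) * p with hps
  set dK : ℤ := NumberField.discr K with hdK
  have hdK0 : dK ≠ 0 := NumberField.discr_ne_zero K
  have hdKneg : dK < 0 := hK.discr_neg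
  -- the bad primes
  have hpN : p ∣ W.conductorNorm ℤ :=
    (W.dvd_conductorNorm_iff_not_hasGoodReductionAtPrime p).mpr hcell.2.1.1
  have hNW0 : W.conductorNorm ℤ ≠ 0 := (W.conductorNorm_pos_holds).ne'
  -- §a the good-ordinary partner `V`
  obtain ⟨V, iV, iVm, CV, hCV, hordV, ⟨C', hC'⟩, hNWV, hpNV, hrootW⟩ :=
    exists_goodOrd_partner_rootNumber W p hmod hp5 hcell
  have hNV0 : V.conductorNorm ℤ ≠ 0 := (V.conductorNorm_pos_holds).ne'
  have hNVW : V.conductorNorm ℤ ∣ W.conductorNorm ℤ := ⟨p ^ 2, hNWV⟩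
  -- §b the genus factorisation `d_K = e₂ δ₁`
  obtain ⟨e₂, δ, he₂, hfac, hδ4, hδsq, hδ2, hpδ, hδgood⟩ := genusFactor_two_spec (p := p) W K hK h2d hsplit hpN
  rw [← hdK] at hfac
  have h2dK : (2 : ℤ) ∣ dK := by rw [hdK]; exact h2d
  -- make `d_K` opaque (its value is never unfolded again; this keeps `isDefEq` cheap)
  clear_value dK
  have hδ0 : δ ≠ 0 := by rintro h; rw [h, mul_zero] at hfac; exact hdK0 hfac
  have hpsδ0 : ps * δ ≠ 0 := mul_ne_zero (by
    rw [hps]; exact mul_ne_zero (pow_ne_zero _ (by norm_num)) (by exact_mod_cast hp.out.ne_zero)) hδ0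
  have he₂8 : e₂ ∣ 8 := by rcases he₂ with h | h | h <;> rw [h] <;> norm_num
  -- §c the auxiliary prime `ℓ₀`
  set σ : ℤ := - Int.sign (ps * δ) with hσ
  have hσ1 : σ = 1 ∨ σ = -1 := by
    rcases lt_trichotomy (ps * δ) 0 with h | h | h
    · left; rw [hσ, Int.sign_eq_neg_one_of_neg h]; norm_num
    · exact (hpsδ0 h).elim
    · right; rw [hσ, Int.sign_eq_one_of_pos h]
  set M : ℕ := W.conductorNorm ℤ * M₀ with hM
  have hM0 : M ≠ 0 := mul_ne_zero hNW0 hM₀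
  set Scrt : Finset ℕ := M.primeFactors.erase 2 with hScrt
  have hScrt_mem : ∀ ℓ, ℓ ∈ Scrt ↔ ℓ.Prime ∧ ℓ ∣ M ∧ ℓ ≠ 2 := fun ℓ ↦ by
    rw [hScrt, Finset.mem_erase, Nat.mem_primeFactors]; tauto
  set η : ℕ → ℤ := fun ℓ ↦ if ℓ = p then 1 else J(ps * e₂ | ℓ) with hη
  have hη1 : ∀ ℓ ∈ Scrt, η ℓ = 1 ∨ η ℓ = -1 := by
    intro ℓ hℓ
    obtain ⟨hℓp, -, hℓ2⟩ := (hScrt_mem ℓ).mp hℓ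
    simp only [hη]
    split_ifs with h1
    · exact Or.inl rfl
    · have hnd : ¬ (ℓ : ℤ) ∣ ps * e₂ := by
        intro hd
        rcases Int.Prime.dvd_mul' hℓp hd with hd | hd
        · exact h1 (eq_of_prime_dvd_pStar (p := p) hℓp hd)
        · have h8 : (ℓ : ℤ) ∣ 8 := hd.trans he₂8
          have h8' : ℓ ∣ 2 ^ 3 := by exact_mod_cast h8
          exact hℓ2 ((Nat.prime_dvd_prime_iff_eq hℓp Nat.prime_two).mp (hℓp.dvd_of_dvd_pow h8'))
      rcases jacobiSym.trichotomy (ps * e₂) ℓ with h0 | h0 | h0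
      · exfalso
        have := jacobiSym_mul_self_eq_one hℓp hnd
        rw [h0, mul_zero] at this
        exact zero_ne_one this
      · exact Or.inl h0
      · exact Or.inr h0
  set B : ℕ := M * dK.natAbs with hB
  obtain ⟨ℓ₀, hℓ₀, hBℓ₀, hσℓ₀, h8ℓ₀, hJℓ₀⟩ :=
    exists_prime_star_prescribed_two hp.out hp2 hδ4 hσ1
      Scrt (fun ℓ hℓ ↦ ⟨((hScrt_mem ℓ).mp hℓ).1, ((hScrt_mem ℓ).mp hℓ).2.2⟩) η hη1 B
  set ls : ℤ := (-1 : ℤ) ^ (ℓ₀ / 2) * ℓ₀ with hls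
  -- `ℓ₀` is large: it divides neither `M = N_E M₀` nor `d_K`, and `ℓ₀ ∉ {2, p}`
  have hB0 : B ≠ 0 := mul_ne_zero hM0 (Int.natAbs_ne_zero.mpr hdK0)
  have hℓ₀M : ¬ ℓ₀ ∣ M := fun h ↦ by
    have := Nat.le_of_dvd (Nat.pos_of_ne_zero hM0) h
    have : M ≤ B := Nat.le_mul_of_pos_right M (Nat.pos_of_ne_zero (Int.natAbs_ne_zero.mpr hdK0))
    omega
  have hℓ₀dK : ¬ (ℓ₀ : ℤ) ∣ dK := fun h ↦ by
    have h' : ℓ₀ ∣ dK.natAbs := by simpa using Int.natAbs_dvd_natAbs.mpr h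
    have := Nat.le_of_dvd (Nat.pos_of_ne_zero (Int.natAbs_ne_zero.mpr hdK0)) h'
    have : dK.natAbs ≤ B := Nat.le_mul_of_pos_left _ (Nat.pos_of_ne_zero hM0)
    omega
  have hℓ₀NW : ¬ ℓ₀ ∣ W.conductorNorm ℤ := fun h ↦ hℓ₀M (h.mul_right _)
  have hℓ₀M₀ : ¬ ℓ₀ ∣ M₀ := fun h ↦ hℓ₀M (h.mul_left _)
  have hℓ₀p : ℓ₀ ≠ p := fun h ↦ hℓ₀NW (h ▸ hpN)
  have hℓ₀2 : ℓ₀ ≠ 2 := by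
    rintro rfl
    exact hℓ₀dK (by exact_mod_cast h2dK)
  have hℓ₀δ : ¬ (ℓ₀ : ℤ) ∣ δ := fun h ↦ hℓ₀dK (h.trans ⟨e₂, by rw [mul_comm]; exact hfac⟩)
  have hℓ₀odd : ℓ₀ % 2 = 1 := Nat.odd_iff.mp (hℓ₀.eq_two_or_odd'.resolve_left hℓ₀2)
  have hls4 : ls % 4 = 1 := (haveI := Fact.mk hℓ₀; pStar_emod_four (p := ℓ₀) hℓ₀2)
  have hps4 : ps % 4 = 1 := pStar_emod_four (p := p) hp2
  -- §d the auxiliary twist `T = δ₁ ℓ₀*` and `X ≅ V^{(T)}` with `w(X) = −1`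
  set T : ℤ := δ * ls with hT
  have hT4 : T % 4 = 1 := by
    rw [hT, Int.mul_emod, hδ4, hls4]; decide
  have hT0 : T ≠ 0 := by rintro h; rw [h] at hT4; norm_num at hT4
  have hTq : (T : ℚ) ≠ 0 := by exact_mod_cast hT0
  -- the sign hypotheses of `jacobiSym_rootNumber_sign`
  have hVroot : V.rootNumber = 1 ∨ V.rootNumber = -1 := V.rootNumber_eq_one_or
  have h1 : J(-1 | p) * J((V.conductorNorm ℤ : ℤ) | p) * V.rootNumber = 1 := by rw [← hrootW, hw]
  have hpsT : ps * T = (ps * δ) * ls := by rw [hT]; ring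
  have hb : ∀ ℓ : ℕ, ℓ.Prime → ℓ ∣ V.conductorNorm ℤ → ℓ ≠ 2 → J(ps * T | ℓ) = 1 := by
    intro ℓ hℓ hℓN hℓ2
    have hℓW : ℓ ∣ W.conductorNorm ℤ := hℓN.trans hNVW
    have hℓp : ℓ ≠ p := by rintro rfl; exact hpNV hℓN
    have hJ' : J(ls | ℓ) = J(ps * e₂ | ℓ) := by
      have := hJℓ₀ ℓ ((hScrt_mem ℓ).mpr ⟨hℓ, hℓW.mul_right _, hℓ2⟩)
      simp only [hη, hℓp, if_false] at this
      exact this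
    have hdKℓ : J(dK | ℓ) = 1 := by
      rw [hdK]
      exact (Quadratic.ncard_primesOver_eq_two_iff_jacobiSym hK.1 hℓ hℓ2).mp (hsplit ℓ hℓ hℓW hℓ2)
    have hpsℓ : ¬ (ℓ : ℤ) ∣ ps := fun hd ↦ hℓp (eq_of_prime_dvd_pStar (p := p) hℓ hd)
    have e1 : J(ps * T | ℓ) = J(ps * δ | ℓ) * J(ls | ℓ) := by
      rw [hpsT]; exact jacobiSym.mul_left _ _ _
    have e2 : J(ps * δ | ℓ) = J(ps | ℓ) * J(δ | ℓ) := jacobiSym.mul_left _ _ _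
    have e3 : J(ps * e₂ | ℓ) = J(ps | ℓ) * J(e₂ | ℓ) := jacobiSym.mul_left _ _ _
    have e4 : J(e₂ * δ | ℓ) = J(e₂ | ℓ) * J(δ | ℓ) := jacobiSym.mul_left _ _ _
    have hsq := jacobiSym_mul_self_eq_one hℓ hpsℓ
    have hqδ1 : J(e₂ | ℓ) * J(δ | ℓ) = 1 := by rw [← e4, ← hfac, hdKℓ]
    rw [e1, hJ', e2, e3]
    calc J(ps | ℓ) * J(δ | ℓ) * (J(ps | ℓ) * J(e₂ | ℓ))
        = (J(ps | ℓ) * J(ps | ℓ)) * (J(e₂ | ℓ) * J(δ | ℓ)) := by ring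
      _ = 1 := by rw [hsq, hqδ1, one_mul]
  have h8' : (ps * T) % 8 = 1 := by
    have e : ps * T = ps * δ * ls := by rw [hT]; ring
    rw [e]; exact h8ℓ₀
  have h8 : 2 ∣ V.conductorNorm ℤ → (ps * T) % 8 = 1 := fun _ ↦ h8'
  have hneg : ps * T < 0 := by
    rw [hpsT, hls, hσℓ₀, hσ]
    have habs : (ps * δ) * Int.sign (ps * δ) = ((ps * δ).natAbs : ℤ) := Int.mul_sign_self (ps * δ)
    have hpos : (0 : ℤ) < (ps * δ).natAbs := by exact_mod_cast Int.natAbs_pos.mpr hpsδ0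
    have hℓ₀pos : (0 : ℤ) < ℓ₀ := by exact_mod_cast hℓ₀.pos
    nlinarith [habs, hpos, hℓ₀pos]
  obtain ⟨X, iX, iXm, CX, hCX⟩ := exists_isGloballyMinimal_smul_eq_quadraticTwist V hTq
  haveI := V.isElliptic_quadraticTwist hTq
  have hXroot : X.rootNumber = -1 := by
    have hgcd : Int.gcd T (V.conductorNorm ℤ) = 1 := by
      rw [Int.gcd_eq_natAbs, Int.natAbs_natCast]
      refine Nat.coprime_of_dvd fun ℓ hℓ hℓT hℓN ↦ ?_
      have hℓT' : (ℓ : ℤ) ∣ T := by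
        have := Int.natAbs_dvd_natAbs.mp (by simpa using hℓT : (ℓ : ℤ).natAbs ∣ T.natAbs); exact this
      rw [hT] at hℓT'
      rcases Int.Prime.dvd_mul' hℓ hℓT' with h | h
      · exact hδgood ℓ hℓ h (hℓN.trans hNVW)
      · have h' : ℓ ∣ ls.natAbs := by simpa using Int.natAbs_dvd_natAbs.mpr h
        rw [hls, natAbs_pStar] at h'
        rw [(Nat.prime_dvd_prime_iff_eq hℓ hℓ₀).mp h'] at hℓN
        exact hℓ₀NW (hℓN.trans hNVW)
    have hTsq : Squarefree T := by
      rw [hT, squarefree_mul_iff]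
      refine ⟨?_, hδsq, ?_⟩
      · refine (Int.isCoprime_iff_gcd_eq_one.mpr ?_).isRelPrime
        rw [Int.gcd_eq_natAbs, hls, natAbs_pStar]
        exact Nat.Coprime.symm ((Nat.Prime.coprime_iff_not_dvd hℓ₀).mpr fun h ↦
          hℓ₀δ (Int.natAbs_dvd_natAbs.mp (by simpa using h)))
      · rw [hls]; exact (haveI := Fact.mk hℓ₀; squarefree_pStar (p := ℓ₀))
    obtain ⟨hrootX, -⟩ := V.rootNumber_quadraticTwist_of_emod_four_eq_one hmod hT4 hTsq hgcd
    rw [← hCX, X.rootNumber_smul_holds CX] at hrootX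
    -- wait: `(CX • X).rootNumber = X.rootNumber`; we need `X.rootNumber = (V.qT T).rootNumber`
    rw [hrootX]
    exact jacobiSym_rootNumber_sign hp.out hp2 hT4 hNV0 hVroot h1 hb h8 hneg
  refine ⟨V, iV, iVm, C', e₂, δ, ℓ₀, X, iX, iXm, CX, hC', hordV, hNWV, he₂, hfac, hδ4, hδsq, hδ2, hpδ, hδ0, hℓ₀, hℓ₀p,
    hℓ₀2, hℓ₀M, hℓ₀δ, hℓ₀dK, h8ℓ₀, fun ℓ hℓ hℓM hℓ2 hℓp ↦ ?_, hT4, hneg, hb, h8', hCX, hXroot⟩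
  have := hJℓ₀ ℓ ((hScrt_mem ℓ).mpr ⟨hℓ, hℓM, hℓ2⟩)
  simp only [hη, hℓp, if_false] at this
  exact this

end AuxTwistTwo

end Summit.BirchSwinnertonDyer.BirchSwinnertonDyer.Theorems.WanAnyRoad

end
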